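import Mathlib
import HarnessLib
import Literature.MathematicalPhysics.KineticTheory.HardSphereEulerProofs
import Summits.AtomisticToContinuum.HydrodynamicLimit.Theses.OneFlightGossipEngine
import Summits.AtomisticToContinuum.HydrodynamicLimit.Theorems.OneFlightGossipEngineKineticCurrentsWindowLDSplit
import Summits.AtomisticToContinuum.HydrodynamicLimit.Theorems.OneFlightGossipEngineKineticCurrentsWindowLDApriori
import Summits.AtomisticToContinuum.HydrodynamicLimit.Theorems.OneFlightGossipEngineKineticCurrentsWindowLDUniformAssembly

/-!
# The net transfer — stub `stub_transferByNets` of line `Sketch`,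
# crux `KineticCurrentsLDAlongFamilies` (stmt-AtomisticToContinuum-16659)

Route `OneFlightGossipEngine`, sub-problem `HydrodynamicLimit`, stub S7 of the skeleton
`Cruxes/KineticCurrentsLDAlongFamilies/Lines/Sketch.lean` (card `skolem-only-in-beta`): the crux
`KineticCurrentsLDAlongFamilies` (wrapped in `id`, which keeps the registered stub signature under the gate's
4000-character cap; window LD bound `∫ exp(β Σᵢ w⁻¹∫₀ʷ F_s(Φ_r z i) dr) dλ^N_s ≤ exp(ε(N+1))`, `w = τ(N+1)^{-1/3}`,
thresholds uniform in `s ∈ [0, t₁]`) from four neighbour shapes taken as hypotheses: (hK) the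
pointwise rung with a NUMERIC tilt threshold `β₀(Θ, U, C, Λ, σ)` (S1); (hT) exponential moments of
the window-averaged velocity tails, uniform in `s` (output of S4); (hR) the static change of
reference law `∫ g dλ_{s'} ≤ (∫ g² dλ_s)^{1/2} e^{κ(N+1)}` for `|s − s'| ≤ δ` (S5); (hB) numeric
bounds of the profiles and one joint modulus of the class functional on velocity balls (S6).
The proof is a finite net in `s` (S1 at the nodes with tilt `4β`) plus two Cauchy–Schwarz steps
(`lintegral_exp_window_add_le`) and the pathwise bound `ω(N+1) + 6C·(window tails)` of the
difference of two nearby class functionals along good orbits (`intervalIntegrable_comp_orbit`).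

References: S. Olla, S. R. S. Varadhan, H.-T. Yau, Comm. Math. Phys. 155 (1993) §2; H. Spohn,
*Large Scale Dynamics of Interacting Particles* (1991), Part I §2.3.
-/

noncomputable section

open MeasureTheory Set Filter
open scoped ENNReal Topology

namespace Summit.AtomisticToContinuum.HydrodynamicLimit.Theorems.KineticCurrentsLDAlongFamiliesSketch

open Literature.Analysis.FluidPDE (HardSphereFlow Config localMaxwellian canonicalDensity liouville)
open Literature.MathematicalPhysics.KineticTheory (T3 V3 hsDiameter localGibbsLaw localGibbsMeasure
  localGibbsProfile)
open Literature.Analysis.FluidPDE Literature.MathematicalPhysics.KineticTheory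
open Summit.AtomisticToContinuum.HydrodynamicLimit.Theses.OneFlightGossipEngine (KineticCurrentsLDAlongFamilies)

/-- Members of the class `F(x,v) = A(x):w⊗w + (b(x)·w) G(x,‖w‖²)`, `w = v − u₀(x)`, are continuous
for continuous `A, b, G, u₀`. [folklore] -/
theorem tbn_continuous_kcw {A : T3 → Fin 3 → Fin 3 → ℝ} {b : T3 → V3} {G : T3 × ℝ → ℝ}
    {u₀ : T3 → V3} (hA : Continuous A) (hb : Continuous b) (hG : Continuous G)
    (hu : Continuous u₀) :
    Continuous fun y : T3 × V3 =>
      (∑ j : Fin 3, ∑ k : Fin 3, A y.1 j k * ((y.2 - u₀ y.1) j * (y.2 - u₀ y.1) k)) +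
        (∑ j : Fin 3, b y.1 j * (y.2 - u₀ y.1) j) * G (y.1, ‖y.2 - u₀ y.1‖ ^ 2) := by
  fun_prop

/-- Finite-net bookkeeping of thresholds: per-node window thresholds `τ₀(k) > 0` and, for
`τ ≥ τ₀(k)`, size thresholds `N₀(k, τ)` beyond which `P k τ N` holds, give one `τ₀` (sum over the
finite set `S`, plus one) and, for `τ ≥ τ₀`, one `N₀` serving every node of `S`. [folklore] -/
theorem tbn_net_thresholds {P : ℕ → ℝ → ℕ → Prop} (S : Finset ℕ)
    (h : ∀ k, ∃ τ₀ : ℝ, 0 < τ₀ ∧ ∀ τ : ℝ, τ₀ ≤ τ → ∃ N₀ : ℕ, ∀ N : ℕ, N₀ ≤ N → P k τ N) :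
    ∃ τ₀ : ℝ, 0 < τ₀ ∧ ∀ τ : ℝ, τ₀ ≤ τ → ∃ N₀ : ℕ, ∀ N : ℕ, N₀ ≤ N → ∀ k ∈ S, P k τ N := by
  choose τf hτf hN using h
  refine ⟨(∑ k ∈ S, τf k) + 1,
    add_pos_of_nonneg_of_pos (Finset.sum_nonneg fun k _ => (hτf k).le) one_pos, fun τ hτ => ?_⟩
  have hτk : ∀ k ∈ S, τf k ≤ τ := fun k hk =>
    ((Finset.single_le_sum (fun k _ => (hτf k).le) hk).trans
      (le_add_of_nonneg_right zero_le_one)).trans hτ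
  have hN' : ∀ k, ∃ N₀ : ℕ, k ∈ S → ∀ N : ℕ, N₀ ≤ N → P k τ N := by
    intro k
    by_cases hk : k ∈ S
    · obtain ⟨N₀, hN₀⟩ := hN k τ (hτk k hk)
      exact ⟨N₀, fun _ => hN₀⟩
    · exact ⟨0, fun h => absurd h hk⟩
  choose Nf hNf using hN'
  exact ⟨∑ k ∈ S, Nf k, fun N hNN k hk => hNf k hk N
    ((Finset.single_le_sum (fun k _ => Nat.zero_le (Nf k)) hk).trans hNN)⟩

/-- Off the velocity ball the quadratic growth takes over: if `|F' − F₁| ≤ ω` for `‖v‖ ≤ √(2V)`,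
both functionals have growth `C(1+‖v‖²)` and `V ≥ 1`, then `|F' − F₁| ≤ ω + 6C·max 0 (‖v‖² − V)`
everywhere (for `‖v‖² > 2V`, `2C(1+‖v‖²) ≤ 6C(‖v‖² − V)` as `1 + 3V ≤ 4V < 2‖v‖²`). [folklore] -/
theorem tbn_abs_sub_le_of_modulus {F₁ F' : T3 × V3 → ℝ} {C V ω : ℝ} (hC : 0 ≤ C) (hV : 1 ≤ V)
    (hω : 0 ≤ ω) (h₁ : ∀ y, |F₁ y| ≤ C * (1 + ‖y.2‖ ^ 2)) (h' : ∀ y, |F' y| ≤ C * (1 + ‖y.2‖ ^ 2))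
    (hmod : ∀ (x : T3) (v : V3), ‖v‖ ≤ Real.sqrt (2 * V) → |F' (x, v) - F₁ (x, v)| ≤ ω) :
    ∀ y, |F' y - F₁ y| ≤ ω + 6 * C * max 0 (‖y.2‖ ^ 2 - V) := by
  rintro ⟨x, v⟩
  dsimp only
  have hmax : 0 ≤ max 0 (‖v‖ ^ 2 - V) := le_max_left _ _
  by_cases hv : ‖v‖ ≤ Real.sqrt (2 * V)
  · exact (hmod x v hv).trans (le_add_of_nonneg_right (by positivity))
  · have h2V : 2 * V < ‖v‖ ^ 2 := Real.lt_sq_of_sqrt_lt (not_le.1 hv)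
    have ha := abs_le.1 (h' (x, v))
    have hb := abs_le.1 (h₁ (x, v))
    have hCv : 0 ≤ C * (4 * ‖v‖ ^ 2 - 6 * V - 2) := mul_nonneg hC (by linarith)
    rw [max_eq_right (by linarith : (0 : ℝ) ≤ ‖v‖ ^ 2 - V), abs_le]
    constructor <;> nlinarith [ha.1, ha.2, hb.1, hb.2, hCv]

/-- **The difference factor is dominated by the window tails.** For a law `μ` carried by the good
set, continuous `F₁, F'` with `|F' − F₁| ≤ ω + L·max 0 (‖v‖² − V)`, `w > 0`, `|β|ωn ≤ c`, `|β|L ≤ γ`: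
pathwise `β Σᵢ w⁻¹∫₀ʷ (F' − F₁) ≤ |β|ωn + |β|L·Σᵢ w⁻¹∫₀ʷ max 0 (‖vᵢ(r)‖² − V) dr` on good orbits, so
`∫ exp(β Σᵢ w⁻¹∫₀ʷ (F' − F₁)) dμ ≤ e^{c} ∫ exp(γ Σᵢ w⁻¹∫₀ʷ max 0 (‖vᵢ(r)‖² − V) dr) dμ`. [folklore] -/
theorem tbn_lintegral_exp_window_sub_le {ε : ℝ} {n : ℕ}
    (Φ : HardSphereFlow (Torus.geometry (Fin 3)) ε n) {μ : Measure (Config n (Fin 3) T3)}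
    (hμ : μ Φ.goodᶜ = 0) {F₁ F' : T3 × V3 → ℝ} (hF₁ : Continuous F₁) (hF' : Continuous F')
    {ω L V : ℝ} (hdiff : ∀ y, |F' y - F₁ y| ≤ ω + L * max 0 (‖y.2‖ ^ 2 - V))
    {w : ℝ} (hw : 0 < w) (β : ℝ) {c γ : ℝ} (hc : |β| * ω * n ≤ c) (hγ : |β| * L ≤ γ) :
    ∫⁻ z, ENNReal.ofReal (Real.exp (β * ∑ i, w⁻¹ * ∫ r in (0 : ℝ)..w,
        (F' - F₁) (Φ.flow r z i))) ∂μ ≤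
      ENNReal.ofReal (Real.exp c) *
        ∫⁻ z, ENNReal.ofReal (Real.exp (γ * ∑ i, w⁻¹ * ∫ r in (0 : ℝ)..w,
          max 0 (‖(Φ.flow r z i).2‖ ^ 2 - V))) ∂μ := by
  have hgood : ∀ᵐ z ∂μ, z ∈ Φ.good :=
    measure_eq_zero_iff_ae_notMem.1 hμ |>.mono fun z hz => by simpa using hz
  have hY : Continuous fun y : T3 × V3 => max 0 (‖y.2‖ ^ 2 - V) :=
    continuous_const.max ((continuous_snd.norm.pow 2).sub continuous_const)
  have _hR : Continuous (F' - F₁) := hF'.sub hF₁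
  refine (lintegral_mono_ae ?_).trans_eq (lintegral_const_mul' _ _ ENNReal.ofReal_ne_top)
  filter_upwards [hgood] with z hz
  rw [← ENNReal.ofReal_mul (Real.exp_nonneg _), ← Real.exp_add]
  refine ENNReal.ofReal_le_ofReal (Real.exp_le_exp.2 ?_)
  have hi : ∀ i, β * (w⁻¹ * ∫ r in (0 : ℝ)..w, (F' - F₁) (Φ.flow r z i)) ≤
      |β| * ω + |β| * L * (w⁻¹ * ∫ r in (0 : ℝ)..w, max 0 (‖(Φ.flow r z i).2‖ ^ 2 - V)) := by
    intro i
    have hYi := intervalIntegrable_comp_orbit Φ hz hY i 0 w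
    have h := intervalIntegral.norm_integral_le_of_norm_le hw.le
      (ae_of_all _ fun r _ => (Real.norm_eq_abs _).trans_le (hdiff (Φ.flow r z i)))
      ((intervalIntegrable_const (c := ω)).add (hYi.const_mul L))
    rw [intervalIntegral.integral_add (intervalIntegrable_const (c := ω)) (hYi.const_mul L),
      intervalIntegral.integral_const, intervalIntegral.integral_const_mul, sub_zero, smul_eq_mul,
      Real.norm_eq_abs] at h
    have h1 : β * (w⁻¹ * ∫ r in (0 : ℝ)..w, (F' - F₁) (Φ.flow r z i)) ≤
        |β| * (w⁻¹ * (w * ω + L * ∫ r in (0 : ℝ)..w, max 0 (‖(Φ.flow r z i).2‖ ^ 2 - V))) := by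
      refine (le_abs_self _).trans ?_
      rw [abs_mul, abs_mul, abs_of_pos (inv_pos.2 hw)]
      exact mul_le_mul_of_nonneg_left (mul_le_mul_of_nonneg_left h (inv_pos.2 hw).le)
        (abs_nonneg β)
    refine h1.trans_eq ?_
    rw [mul_add, inv_mul_cancel_left₀ hw.ne']
    ring
  calc β * ∑ i, w⁻¹ * ∫ r in (0 : ℝ)..w, (F' - F₁) (Φ.flow r z i)
      = ∑ i, β * (w⁻¹ * ∫ r in (0 : ℝ)..w, (F' - F₁) (Φ.flow r z i)) := Finset.mul_sum _ _ _
    _ ≤ ∑ i, (|β| * ω + |β| * L *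
          (w⁻¹ * ∫ r in (0 : ℝ)..w, max 0 (‖(Φ.flow r z i).2‖ ^ 2 - V))) :=
        Finset.sum_le_sum fun i _ => hi i
    _ = |β| * ω * n +
          |β| * L * ∑ i, w⁻¹ * ∫ r in (0 : ℝ)..w, max 0 (‖(Φ.flow r z i).2‖ ^ 2 - V) := by
        rw [Finset.sum_add_distrib, Finset.sum_const, Finset.card_univ, Fintype.card_fin,
          nsmul_eq_mul, Finset.mul_sum]
        ring
    _ ≤ c + γ * ∑ i, w⁻¹ * ∫ r in (0 : ℝ)..w, max 0 (‖(Φ.flow r z i).2‖ ^ 2 - V) :=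
        add_le_add hc (mul_le_mul_of_nonneg_right hγ (Finset.sum_nonneg fun i _ =>
          mul_nonneg (inv_pos.2 hw).le
            (intervalIntegral.integral_nonneg hw.le fun r _ => le_max_left _ _)))

/-- **Split of the squared functional.** For a law carried by the good set, continuous `F₁, F'`:
`∫ (e^{βW(F')})² dμ ≤ (∫ e^{4βW(F₁)} dμ)^{1/2} (∫ e^{4βW(F'−F₁)} dμ)^{1/2}` (write
`F' = F₁ + (F' − F₁)` and apply `lintegral_exp_window_add_le` at tilt `2β`). [folklore] -/
theorem tbn_lintegral_sq_le_split {ε : ℝ} {n : ℕ}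
    (Φ : HardSphereFlow (Torus.geometry (Fin 3)) ε n) {μ : Measure (Config n (Fin 3) T3)}
    (hμ : μ Φ.goodᶜ = 0) {F₁ F' : T3 × V3 → ℝ} (hF₁ : Continuous F₁) (hF' : Continuous F')
    (w β : ℝ) :
    ∫⁻ z, ENNReal.ofReal (Real.exp (β * ∑ i, w⁻¹ * ∫ r in (0 : ℝ)..w, F' (Φ.flow r z i))) ^ 2 ∂μ ≤
      (∫⁻ z, ENNReal.ofReal (Real.exp (4 * β * ∑ i, w⁻¹ * ∫ r in (0 : ℝ)..w,
          F₁ (Φ.flow r z i))) ∂μ) ^ (1 / 2 : ℝ) *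
        (∫⁻ z, ENNReal.ofReal (Real.exp (4 * β * ∑ i, w⁻¹ * ∫ r in (0 : ℝ)..w,
          (F' - F₁) (Φ.flow r z i))) ∂μ) ^ (1 / 2 : ℝ) := by
  have hR : Continuous (F' - F₁) := hF'.sub hF₁
  have h := lintegral_exp_window_add_le Φ hμ hF₁ hR w (2 * β)
  have h4 : ∀ x : ℝ, 2 * (2 * β * x) = 4 * β * x := fun x => by ring
  simp only [h4] at h
  refine le_trans (le_of_eq (lintegral_congr fun z => ?_)) h
  rw [← ENNReal.ofReal_pow (Real.exp_nonneg _), ← Real.exp_nat_mul, Nat.cast_ofNat]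
  congr 2
  simp only [Pi.sub_apply, add_sub_cancel]
  ring

/-- **The arithmetic of the chain** in `ℝ≥0∞`: `I ≤ J^{1/2} e^{κn}`, `J ≤ K₁^{1/2} K₂^{1/2}`,
`K₁ ≤ e^{εn}`, `K₂ ≤ e^{cn} e^{κn}`, `κ + ε/4 + (c + κ)/4 ≤ ε`, `n ≥ 0` give `I ≤ e^{εn}`. [folklore] -/
theorem tbn_chain_le {I J K₁ K₂ : ℝ≥0∞} {n κ ε c : ℝ}
    (ha : I ≤ J ^ (1 / 2 : ℝ) * ENNReal.ofReal (Real.exp (κ * n)))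
    (hb : J ≤ K₁ ^ (1 / 2 : ℝ) * K₂ ^ (1 / 2 : ℝ))
    (hc : K₁ ≤ ENNReal.ofReal (Real.exp (ε * n)))
    (hd : K₂ ≤ ENNReal.ofReal (Real.exp (c * n)) * ENNReal.ofReal (Real.exp (κ * n)))
    (hn : 0 ≤ n) (hκε : κ + ε / 4 + (c + κ) / 4 ≤ ε) :
    I ≤ ENNReal.ofReal (Real.exp (ε * n)) := by
  have hhalf : ∀ x : ℝ, ENNReal.ofReal (Real.exp x) ^ (1 / 2 : ℝ) =
      ENNReal.ofReal (Real.exp (x / 2)) := by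
    intro x
    rw [ENNReal.ofReal_rpow_of_nonneg (Real.exp_pos _).le (by norm_num), ← Real.exp_mul]
    congr 2
    ring
  have hd' : K₂ ≤ ENNReal.ofReal (Real.exp ((c + κ) * n)) := by
    refine hd.trans_eq ?_
    rw [← ENNReal.ofReal_mul (Real.exp_pos _).le, ← Real.exp_add]
    congr 2
    ring
  calc I ≤ J ^ (1 / 2 : ℝ) * ENNReal.ofReal (Real.exp (κ * n)) := ha
    _ ≤ ((ENNReal.ofReal (Real.exp (ε * n))) ^ (1 / 2 : ℝ) *
          (ENNReal.ofReal (Real.exp ((c + κ) * n))) ^ (1 / 2 : ℝ)) ^ (1 / 2 : ℝ) *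
          ENNReal.ofReal (Real.exp (κ * n)) :=
        mul_le_mul' (ENNReal.rpow_le_rpow (hb.trans (mul_le_mul'
          (ENNReal.rpow_le_rpow hc (by norm_num)) (ENNReal.rpow_le_rpow hd' (by norm_num))))
          (by norm_num)) le_rfl
    _ = ENNReal.ofReal (Real.exp ((ε / 4 + (c + κ) / 4 + κ) * n)) := by
        rw [hhalf, hhalf, ← ENNReal.ofReal_mul (Real.exp_pos _).le, ← Real.exp_add, hhalf,
          ← ENNReal.ofReal_mul (Real.exp_pos _).le, ← Real.exp_add]
        congr 2
        ring
    _ ≤ ENNReal.ofReal (Real.exp (ε * n)) :=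
        ENNReal.ofReal_le_ofReal (Real.exp_le_exp.2 (mul_le_mul_of_nonneg_right (by linarith) hn))

/-- **S7 — the net transfer** (stub `stub_transferByNets` of line `Sketch`, crux
`KineticCurrentsLDAlongFamilies`, stmt-AtomisticToContinuum-16659; card `skolem-only-in-beta`):
the pointwise rung with numeric tilt threshold (S1), the window tails along the family (output of
S4), the static change of reference law (S5) and the family bounds/modulus (S6) imply the crux
(`id KineticCurrentsLDAlongFamilies`, unwrapped by `show`). `η₀ := min(η₀^{S1}, 1/8)`, `β₀ := min(β₁/4, γ₀/(24(C+1)))`, nodes `s_k = min(t₁, kδ)`,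
`τ₀ := Σ_k τ₀(k) + 1`, `N₀ := Σ_k N₀(k,τ) + N₀^{tails}(τ)`; for `s'` and `k = ⌊s'/δ⌋`: change of
law `λ_{s'} → λ_{s_k}`, split `F_{s'} = F_{s_k} + (F_{s'} − F_{s_k})`, S1 at the node with tilt
`4β`, pathwise bound `ω(N+1) + 6C·(window tails)` of the difference, then the tails. [folklore] -/
theorem stub_transferByNets :
    (∃ η₀ : ℝ, 0 < η₀ ∧ ∀ (Θ U C Λ : ℝ), 1 ≤ Θ → 0 ≤ U → 0 ≤ C → 1 ≤ Λ → ∀ σ : ℝ, 0 < σ →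
      ∃ β₀ : ℝ, 0 < β₀ ∧
      ∀ (a θ₀ : T3 → ℝ) (u₀ : T3 → V3), Continuous a → Continuous θ₀ → Continuous u₀ →
      (∀ x, Λ⁻¹ ≤ a x ∧ a x ≤ Λ) → (∀ x, Θ⁻¹ ≤ θ₀ x ∧ θ₀ x ≤ Θ) → (∀ x, ‖u₀ x‖ ≤ U) →
      σ ^ 3 * (⨆ x, a x) ≤ η₀ * ∫ x, a x →
      ∀ Φ : (N : ℕ) →
        HardSphereFlow (Literature.Analysis.FluidPDE.Torus.geometry (Fin 3)) (hsDiameter σ N) (N + 1),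
      ∀ (A : T3 → Fin 3 → Fin 3 → ℝ) (b : T3 → V3) (G : T3 × ℝ → ℝ),
      Continuous A → Continuous b → Continuous G →
      ∀ F : T3 × V3 → ℝ, (∀ y, F y =
        (∑ j : Fin 3, ∑ k : Fin 3, A y.1 j k * ((y.2 - u₀ y.1) j * (y.2 - u₀ y.1) k)) +
          (∑ j : Fin 3, b y.1 j * (y.2 - u₀ y.1) j) * G (y.1, ‖y.2 - u₀ y.1‖ ^ 2)) →
      (∀ y, |F y| ≤ C * (1 + ‖y.2‖ ^ 2)) →
      (∀ x, ∫ v, F (x, v) * localMaxwellian 1 (θ₀ x) (u₀ x) v = 0) →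
      (∀ x (j : Fin 3), ∫ v, F (x, v) * v j * localMaxwellian 1 (θ₀ x) (u₀ x) v = 0) →
      (∀ x, ∫ v, F (x, v) * ‖v‖ ^ 2 * localMaxwellian 1 (θ₀ x) (u₀ x) v = 0) →
      ∀ β : ℝ, |β| ≤ β₀ → ∀ ε : ℝ, 0 < ε → ∃ τ₀ : ℝ, 0 < τ₀ ∧ ∀ τ : ℝ, τ₀ ≤ τ →
      ∃ N₀ : ℕ, ∀ N : ℕ, N₀ ≤ N →
        ∫⁻ z, ENNReal.ofReal (Real.exp (β * ∑ i : Fin (N + 1),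
            (τ * ((N : ℝ) + 1) ^ (-(1 / 3 : ℝ)))⁻¹ *
              ∫ r in (0 : ℝ)..(τ * ((N : ℝ) + 1) ^ (-(1 / 3 : ℝ))), F (((Φ N).flow r z) i)))
          ∂(localGibbsLaw σ a u₀ θ₀ N (Φ N)) ≤
        ENNReal.ofReal (Real.exp (ε * ((N : ℝ) + 1)))) →
    (∀ (t₁ : ℝ) (a θ₀ : ℝ → T3 → ℝ) (u₀ : ℝ → T3 → V3),
      Continuous (Function.uncurry a) → Continuous (Function.uncurry θ₀) →
      Continuous (Function.uncurry u₀) → (∀ s x, 0 < a s x) → (∀ s x, 0 < θ₀ s x) →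
      ∀ σ : ℝ, 0 < σ → σ ≤ 1 / 2 →
      ∀ Φ : (N : ℕ) →
        HardSphereFlow (Literature.Analysis.FluidPDE.Torus.geometry (Fin 3)) (hsDiameter σ N) (N + 1),
      ∃ γ₀ : ℝ, 0 < γ₀ ∧ ∀ γ : ℝ, 0 ≤ γ → γ ≤ γ₀ → ∀ κ : ℝ, 0 < κ → ∃ V : ℝ, 1 ≤ V ∧
      ∀ τ : ℝ, 0 < τ → ∃ N₀ : ℕ, ∀ N : ℕ, N₀ ≤ N → ∀ s ∈ Icc 0 t₁,
        ∫⁻ z, ENNReal.ofReal (Real.exp (γ * ∑ i : Fin (N + 1),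
            (τ * ((N : ℝ) + 1) ^ (-(1 / 3 : ℝ)))⁻¹ *
              ∫ r in (0 : ℝ)..(τ * ((N : ℝ) + 1) ^ (-(1 / 3 : ℝ))),
                max 0 (‖(((Φ N).flow r z) i).2‖ ^ 2 - V)))
          ∂(localGibbsLaw σ (a s) (u₀ s) (θ₀ s) N (Φ N)) ≤
        ENNReal.ofReal (Real.exp (κ * ((N : ℝ) + 1)))) →
    (∀ (t₁ : ℝ) (a θ₀ : ℝ → T3 → ℝ) (u₀ : ℝ → T3 → V3),
      Continuous (Function.uncurry a) → Continuous (Function.uncurry θ₀) →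
      Continuous (Function.uncurry u₀) → (∀ s x, 0 < a s x) → (∀ s x, 0 < θ₀ s x) →
      ∀ σ : ℝ, 0 < σ → σ ≤ 1 / 2 → ∀ κ : ℝ, 0 < κ → ∃ δ : ℝ, 0 < δ ∧
      ∀ Φ : (N : ℕ) →
        HardSphereFlow (Literature.Analysis.FluidPDE.Torus.geometry (Fin 3)) (hsDiameter σ N) (N + 1),
      ∀ N : ℕ, ∀ s ∈ Icc 0 t₁, ∀ s' ∈ Icc 0 t₁, |s - s'| ≤ δ →
      ∀ g : Config (N + 1) (Fin 3) T3 → ℝ≥0∞,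
        AEMeasurable g
          (liouville (Literature.Analysis.FluidPDE.Torus.geometry (Fin 3)) (N + 1) (hsDiameter σ N)) →
        ∫⁻ z, g z ∂(localGibbsLaw σ (a s') (u₀ s') (θ₀ s') N (Φ N)) ≤
          (∫⁻ z, g z ^ 2 ∂(localGibbsLaw σ (a s) (u₀ s) (θ₀ s) N (Φ N))) ^ (1 / 2 : ℝ) *
            ENNReal.ofReal (Real.exp (κ * ((N : ℝ) + 1)))) →
    (∀ (t₁ : ℝ) (a θ₀ : ℝ → T3 → ℝ) (u₀ : ℝ → T3 → V3),
      Continuous (Function.uncurry a) → Continuous (Function.uncurry θ₀) →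
      Continuous (Function.uncurry u₀) → (∀ s x, 0 < a s x) → (∀ s x, 0 < θ₀ s x) →
      ∀ (A : ℝ → T3 → Fin 3 → Fin 3 → ℝ) (b : ℝ → T3 → V3) (G : ℝ → T3 × ℝ → ℝ),
      Continuous (Function.uncurry A) → Continuous (Function.uncurry b) →
      Continuous (Function.uncurry G) →
      ∀ F : ℝ → T3 × V3 → ℝ, (∀ s y, F s y =
        (∑ j : Fin 3, ∑ k : Fin 3, A s y.1 j k * ((y.2 - u₀ s y.1) j * (y.2 - u₀ s y.1) k)) +
          (∑ j : Fin 3, b s y.1 j * (y.2 - u₀ s y.1) j) * G s (y.1, ‖y.2 - u₀ s y.1‖ ^ 2)) →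
      ∃ Θ U Λ : ℝ, 1 ≤ Θ ∧ 0 ≤ U ∧ 1 ≤ Λ ∧
        (∀ s ∈ Icc 0 t₁, ∀ x, Θ⁻¹ ≤ θ₀ s x ∧ θ₀ s x ≤ Θ) ∧
        (∀ s ∈ Icc 0 t₁, ∀ x, ‖u₀ s x‖ ≤ U) ∧
        (∀ s ∈ Icc 0 t₁, ∀ x, Λ⁻¹ ≤ a s x ∧ a s x ≤ Λ) ∧
        ∀ R : ℝ, ∀ ω : ℝ, 0 < ω → ∃ δ : ℝ, 0 < δ ∧
          ∀ s ∈ Icc 0 t₁, ∀ s' ∈ Icc 0 t₁, |s - s'| ≤ δ →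
          ∀ (x : T3) (v : V3), ‖v‖ ≤ R → |F s (x, v) - F s' (x, v)| ≤ ω) →
    id KineticCurrentsLDAlongFamilies := by
  intro hK hT hR hB
  show KineticCurrentsLDAlongFamilies; delta KineticCurrentsLDAlongFamilies
  obtain ⟨η₁, hη₁, hK'⟩ := hK
  refine ⟨min η₁ (1 / 8), lt_min hη₁ (by norm_num), ?_⟩
  intro t₁ a θ₀ u₀ ha hθ hu ha0 hθ0 σ hσ hguard Φ A b G hA hb hG F hC h1 hv hE
  have hFc : ∀ s, Continuous (F s) := fun s =>
    tbn_continuous_kcw (hA.uncurry_left s) (hb.uncurry_left s) (hG.uncurry_left s)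
      (hu.uncurry_left s)
  -- the degenerate parameter interval `t₁ < 0`: everything is vacuous
  by_cases ht : t₁ < 0
  · refine ⟨1, one_pos, fun β _ ε _ => ⟨1, one_pos, fun τ _ => ⟨0, fun N _ s hs => ?_⟩⟩⟩
    exact absurd (hs.1.trans hs.2) (not_le.2 ht)
  replace ht : 0 ≤ t₁ := not_lt.1 ht
  have h0 : (0 : ℝ) ∈ Icc 0 t₁ := ⟨le_rfl, ht⟩
  -- Step 1: the guard gives `σ ≤ 1/2` (at `s = 0`) and the S1-guard at every `s`
  have hint_le : ∀ s, ∫ x, a s x ≤ ⨆ x, a s x := fun s =>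
    KineticCurrentsWindowLDUniformSketch.integral_le_iSup_T3 (ha.uncurry_left s)
  have hint_nn : ∀ s, 0 ≤ ∫ x, a s x := fun s => integral_nonneg fun x => (ha0 s x).le
  have hguard1 : ∀ s ∈ Icc 0 t₁, σ ^ 3 * (⨆ x, a s x) ≤ η₁ * ∫ x, a s x := fun s hs =>
    (hguard s hs).trans (mul_le_mul_of_nonneg_right (min_le_left _ _) (hint_nn s))
  have hσ2 : σ ≤ 1 / 2 := by
    have h8 : σ ^ 3 * (⨆ x, a 0 x) ≤ 1 / 8 * (⨆ x, a 0 x) :=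
      (hguard 0 h0).trans ((mul_le_mul_of_nonneg_right (min_le_right _ _) (hint_nn 0)).trans
        (mul_le_mul_of_nonneg_left (hint_le 0) (by norm_num)))
    have hsup_pos : 0 < ⨆ x, a 0 x :=
      lt_of_lt_of_le (ha0 0 0) (le_ciSup (isCompact_range (ha.uncurry_left 0)).bddAbove 0)
    have h8' : σ ^ 3 ≤ (1 / 2) ^ 3 := by nlinarith
    exact le_of_pow_le_pow_left₀ (by norm_num) (by norm_num) h8'
  -- Step 2: the constants of the family (S6), the growth constant, `β₁` (S1), `γ₀` (tails)
  obtain ⟨Θ, U, Λ, hΘ1, hU0, hΛ1, hΘb, hUb, hΛb, hmod⟩ :=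
    hB t₁ a θ₀ u₀ ha hθ hu ha0 hθ0 A b G hA hb hG F (fun s y => rfl)
  obtain ⟨C, hCb⟩ := hC
  have hC0 : 0 ≤ C := growthConst_nonneg (hCb 0 h0)
  obtain ⟨β₁, hβ₁, hK1⟩ := hK' Θ U C Λ hΘ1 hU0 hC0 hΛ1 σ hσ
  obtain ⟨γ₀, hγ₀, hT1⟩ := hT t₁ a θ₀ u₀ ha hθ hu ha0 hθ0 σ hσ hσ2 Φ
  refine ⟨min (β₁ / 4) (γ₀ / (24 * (C + 1))), lt_min (by positivity) (by positivity), ?_⟩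
  intro β hβ ε hε
  have hβ1 : |β| ≤ β₁ / 4 := hβ.trans (min_le_left _ _)
  have hβ2 : |β| ≤ γ₀ / (24 * (C + 1)) := hβ.trans (min_le_right _ _)
  have h4 : |4 * β| = 4 * |β| := by rw [abs_mul, abs_of_pos (by norm_num : (0 : ℝ) < 4)]
  have h4β : |4 * β| ≤ β₁ := by rw [h4]; linarith
  -- Step 3: the window tails at rate `γ = 24|β|C`, precision `ε/4`
  obtain ⟨γ, hγ0, hγle, hγ4⟩ : ∃ γ : ℝ, 0 ≤ γ ∧ γ ≤ γ₀ ∧ |4 * β| * (6 * C) ≤ γ := by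
    refine ⟨24 * |β| * C, by positivity, ?_, by rw [h4]; linarith⟩
    rw [le_div_iff₀ (by positivity)] at hβ2
    nlinarith [abs_nonneg β]
  obtain ⟨V, hV1, hT2⟩ := hT1 γ hγ0 hγle (ε / 4) (by positivity)
  -- Step 4: the joint modulus at radius `√(2V)` and the change of reference law, precision `ε/4`
  obtain ⟨ω, hω, hβω⟩ : ∃ ω : ℝ, 0 < ω ∧ |β| * ω ≤ ε / 4 := by
    refine ⟨ε / 4 / (|β| + 1), by positivity, ?_⟩
    rw [show |β| * (ε / 4 / (|β| + 1)) = ε / 4 * (|β| / (|β| + 1)) by ring]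
    exact mul_le_of_le_one_right (by positivity) ((div_le_one (by positivity)).2 (by linarith))
  obtain ⟨δ₁, hδ₁, hmod1⟩ := hmod (Real.sqrt (2 * V)) ω hω
  obtain ⟨δ₂, hδ₂, hlaw⟩ := hR t₁ a θ₀ u₀ ha hθ hu ha0 hθ0 σ hσ hσ2 (ε / 4) (by positivity)
  obtain ⟨δ, hδ, hδ1, hδ2⟩ : ∃ δ : ℝ, 0 < δ ∧ δ ≤ δ₁ ∧ δ ≤ δ₂ :=
    ⟨min δ₁ δ₂, lt_min hδ₁ hδ₂, min_le_left _ _, min_le_right _ _⟩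
  -- Step 5: the net `s_k = min t₁ (kδ)` and the pointwise rung (S1) at every node, tilt `4β`
  obtain ⟨sk, hsk, hsk_eq⟩ : ∃ sk : ℕ → ℝ, (∀ k, sk k ∈ Icc 0 t₁) ∧
      ∀ k : ℕ, (k : ℝ) * δ ≤ t₁ → sk k = k * δ :=
    ⟨fun k => min t₁ (k * δ), fun k => ⟨le_min ht (by positivity), min_le_left _ _⟩,
      fun k hk => min_eq_right hk⟩
  have hnet := fun k : ℕ =>
    hK1 (a (sk k)) (θ₀ (sk k)) (u₀ (sk k)) (ha.uncurry_left _) (hθ.uncurry_left _)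
      (hu.uncurry_left _) (hΛb _ (hsk k)) (hΘb _ (hsk k)) (hUb _ (hsk k)) (hguard1 _ (hsk k)) Φ
      (A (sk k)) (b (sk k)) (G (sk k)) (hA.uncurry_left _) (hb.uncurry_left _)
      (hG.uncurry_left _) (F (sk k)) (fun y => rfl) (hCb _ (hsk k)) (h1 _ (hsk k))
      (hv _ (hsk k)) (hE _ (hsk k)) (4 * β) h4β ε hε
  obtain ⟨τ₀, hτ₀, hnet'⟩ := tbn_net_thresholds (Finset.range (⌈t₁ / δ⌉₊ + 1)) hnet
  refine ⟨τ₀, hτ₀, fun τ hτ => ?_⟩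
  have hτpos : 0 < τ := hτ₀.trans_le hτ
  obtain ⟨N₁, hN₁⟩ := hnet' τ hτ
  obtain ⟨NT, hNT⟩ := hT2 τ hτpos
  refine ⟨N₁ + NT, fun N hN s' hs' => ?_⟩
  -- Step 6: the nearest node to the left of `s'`
  obtain ⟨k, hkδ, hs'k, hk_mem⟩ : ∃ k : ℕ, (k : ℝ) * δ ≤ s' ∧ s' < k * δ + δ ∧
      k ∈ Finset.range (⌈t₁ / δ⌉₊ + 1) := by
    refine ⟨⌊s' / δ⌋₊, ?_, ?_, ?_⟩
    · have h := Nat.floor_le (div_nonneg hs'.1 hδ.le)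
      rwa [le_div_iff₀ hδ] at h
    · have h := Nat.lt_floor_add_one (s' / δ)
      rw [div_lt_iff₀ hδ] at h
      linarith
    · exact Finset.mem_range.2 (Nat.lt_add_one_iff.2 ((Nat.floor_le_ceil _).trans
        (Nat.ceil_le_ceil (div_le_div_of_nonneg_right hs'.2 hδ.le))))
  have hdist : |sk k - s'| ≤ δ := by
    rw [hsk_eq k (hkδ.trans hs'.2), abs_sub_comm, abs_of_nonneg (by linarith)]
    linarith
  have hw : 0 < τ * ((N : ℝ) + 1) ^ (-(1 / 3 : ℝ)) :=
    mul_pos hτpos (Real.rpow_pos_of_pos (by positivity) _)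
  have hPgood : (localGibbsLaw σ (a (sk k)) (u₀ (sk k)) (θ₀ (sk k)) N (Φ N)) (Φ N).goodᶜ = 0 :=
    localGibbsLaw_absolutelyContinuous σ _ _ _ N (Φ N) (Φ N).measure_compl_good
  -- pointwise `|F_{s'} − F_{s_k}| ≤ ω + 6C·max 0 (‖v‖² − V)`; the window functional is measurable
  have hdiff : ∀ y, |F s' y - F (sk k) y| ≤ ω + 6 * C * max 0 (‖y.2‖ ^ 2 - V) :=
    tbn_abs_sub_le_of_modulus hC0 hV1 hω.le (hCb _ (hsk k)) (hCb s' hs') fun x v hxv =>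
      hmod1 s' hs' (sk k) (hsk k) (by rw [abs_sub_comm]; exact hdist.trans hδ1) x v hxv
  have hmeas : AEMeasurable (fun z => ENNReal.ofReal (Real.exp (β * ∑ i,
      (τ * ((N : ℝ) + 1) ^ (-(1 / 3 : ℝ)))⁻¹ * ∫ r in (0 : ℝ)..(τ * ((N : ℝ) + 1) ^ (-(1 / 3 : ℝ))),
      F s' ((Φ N).flow r z i)))) (liouville (Torus.geometry (Fin 3)) (N + 1) (hsDiameter σ N)) := by
    refine (Real.measurable_exp.comp_aemeasurable (AEMeasurable.const_mul
      (Finset.aemeasurable_fun_sum _ fun i _ => ?_) β)).ennreal_ofReal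
    exact ((Φ N).aemeasurable_intervalIntegral_comp_flow_torus
      ((hFc s').measurable.comp (measurable_pi_apply i)) 0 _ (Φ N).measure_compl_good).const_mul _
  -- (a) change of reference law `λ_{s'} → λ_{s_k}` (S5); (b) split of the square; (c) S1 at the
  -- node, tilt `4β`; (d) the difference via the tails; (e) `ε/4 + ε/4 + (4|β|ω + ε/4)/4 ≤ ε`
  have haa := hlaw Φ N (sk k) (hsk k) s' hs' (hdist.trans hδ2) _ hmeas
  have hbb := tbn_lintegral_sq_le_split (Φ N) hPgood (hFc (sk k)) (hFc s')
    (τ * ((N : ℝ) + 1) ^ (-(1 / 3 : ℝ))) β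
  have hdd := (tbn_lintegral_exp_window_sub_le (Φ N) hPgood (hFc (sk k)) (hFc s') hdiff hw
    (4 * β) (c := 4 * |β| * ω * ((N : ℝ) + 1)) (γ := γ) (by rw [Nat.cast_add_one, h4]) hγ4).trans
    (mul_le_mul' le_rfl (hNT N ((Nat.le_add_left NT N₁).trans hN) (sk k) (hsk k)))
  exact tbn_chain_le haa hbb (hN₁ N ((Nat.le_add_right N₁ NT).trans hN) k hk_mem) hdd
    (by positivity) (by linarith)

end Summit.AtomisticToContinuum.HydrodynamicLimit.Theorems.KineticCurrentsLDAlongFamiliesSketch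

end
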